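import Summits.CriticalPhenomena.Ising3DConformalLimit.Theses.PrecisionLaplacian
import Summits.CriticalPhenomena.Ising3DConformalLimit.Theorems.PrecisionLaplacianDirectCorrelationStableTailSlabSpectralRepresentation
import Summits.CriticalPhenomena.Ising3DConformalLimit.Theorems.PrecisionLaplacianDirectCorrelationStableTailDcfStructure
import Summits.CriticalPhenomena.Ising3DConformalLimit.Theorems.PrecisionLaplacianDirectCorrelationStableTailPickInversion
import Summits.CriticalPhenomena.Ising3DConformalLimit.Theorems.PrecisionLaplacianDirectCorrelationStableTailScaleRegularity
import Summits.CriticalPhenomena.Ising3DConformalLimit.Theorems.PrecisionLaplacianDirectCorrelationStableTailPointwiseUpgrade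
import Summits.CriticalPhenomena.Ising3DConformalLimit.Theorems.PrecisionLaplacianDirectCorrelationStableTailLinearTransverseGapAux
import Summits.CriticalPhenomena.Ising3DConformalLimit.Theorems.PrecisionLaplacianDirectCorrelationStableTailSlabModeExpDecayGreenTransfer
import Summits.CriticalPhenomena.Ising3DConformalLimit.Theorems.PrecisionLaplacianDirectCorrelationStableTailSlabModeExpDecayAxisLineHol
import Summits.CriticalPhenomena.Ising3DConformalLimit.Theorems.PrecisionLaplacianDirectCorrelationStableTailSlabModeExpDecayDiagLineHol
import Summits.CriticalPhenomena.Ising3DConformalLimit.Theorems.PrecisionLaplacianDirectCorrelationStableTailSlabModeExpDecayCrossAssembly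
import Summits.CriticalPhenomena.Ising3DConformalLimit.Theorems.PrecisionLaplacianDirectCorrelationStableTailCrossLemma
import Summits.CriticalPhenomena.Ising3DConformalLimit.Theorems.PrecisionLaplacianEtaBoundsTransferLimit
import Literature.Probability.LatticeModels.CriticalTwoPointLawDimension
import HarnessLib

/-!
# Crux `PrecisionLaplacian.DirectCorrelationStableTail` (stmt-CriticalPhenomena-4799) follows from its EXISTENCE
# CORE alone — closure of line `self-energy-pick-inversion` modulo the one open stub

Lead of the line (prover-line-stmt-CriticalPhenomena-4799-0, 2026-08-16).  Pure theorem file (no definitions):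
the composition of the line's LANDED stubs (all kernel-checked tree theorems of this namespace) into the statement

  `TailRegularVariationCore → DirectCorrelationStableTail`

where `TailRegularVariationCore` is the registered signature of the open existence stub
`stub_tailRegularVariation` written out: under the crux hypothesis `H` (every finite critical kernel matrix is a
symmetric potential), summability of the direct correlation function `a = dcf`, the Hausdorff structure of its
slab modes and the linear transverse gap, THERE ARE `η ∈ (0,1)` and `c > 0` with pure-power slab sums
`S⁽ⁱ⁾(n)·n^{3-η} → c` in every direction and convergence of the rescaled tail measures
`R^{2-η} Σ_x a(x) f(x/R)`.  This hypothesis is where `η(3) > 0` and regular variation live (the crux's own bet);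
everything else of TAIL is proved:

* `stub_dcfStructure` — `H ⇒ a ∈ ℓ¹(ℤ³)` and hyperoctahedral invariance (nine-mirror RP + Cauchy–Schwarz);
* `stub_slabSpectralRepresentation` — general-`v` ADC21 Prop. 8.6 at `β_c(3)`;
* `stub_pickInversion` — the slab modes of `a` are Hausdorff moment sequences at every transverse momentum
  (`−1/Pick ∈ Pick`, Nevanlinna representation);
* THE TRANSVERSE MASS GAP `m(k) ≥ c‖k‖`: `EtaBoundsTransfer.exists_A0`, line holomorphy of the Green symbol along
  the nine reflection-positive frames (`stub_slabModeExpDecay_auxAxisLineHol`, `…auxDiagLineHol`), the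
  Bernstein–Siciak cross lemma (`stub_crossLemma`, from `Literature.Analysis.Complex.CrossTheoremNStrips`), the
  cross assembly (`…auxCrossAssembly`, Paley–Wiener), the lossless `G → a` transfer (`…auxGreenTransfer`) and the
  rigidity of Hausdorff moment sequences (`transverseGap_of_hausdorff_of_eventually_expDecay`);
* `stub_scaleRegularity` — regularity at scale (R1)–(R3) for ANY `a ≥ 0` with that structure;
* `stub_pointwiseUpgrade` — the pointwise stable tail from radial asymptotics + regularity + tail-measure
  convergence, for ANY `a ≥ 0`.

The skeleton `Cruxes/DirectCorrelationStableTail/Lines/self_energy_pick_inversion.lean` (rev 4) contains the same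
composition in package form with `stub_tailRegularVariation` as its only `sorry`.
-/

noncomputable section

namespace Summit.CriticalPhenomena.Ising3DConformalLimit.Cruxes.DirectCorrelationStableTail.SelfEnergyPickInversion

open MeasureTheory Filter Topology
open scoped BigOperators
open Literature.Probability.LatticeModels

/-- Nine-frame line holomorphy of the Green symbol from its axis and diagonal halves (the landed
`stub_slabModeExpDecay_auxAxisLineHol`, `stub_slabModeExpDecay_auxDiagLineHol`): smaller radius constant, larger
bound.  Statement = the lead's interface `lineHolomorphy_SHAPE` (all nine frames). -/
theorem lineHol_nine_of_axis_of_diag :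
    (∀ A : Finset (Site 3), (Matrix.of fun (p q : ↥A) => criticalTwoPoint 3 (q.1 - p.1)).PosDef ∧ ∀ u v :
      ↥A, (u ≠ v → (Matrix.of fun (p q : ↥A) => criticalTwoPoint 3 (q.1 - p.1))⁻¹ u v ≤ 0) ∧ 0 ≤ ∑ w,
      (Matrix.of fun (p q : ↥A) => criticalTwoPoint 3 (q.1 - p.1))⁻¹ u w) →
    ∀ A₀ : ℝ, Filter.Tendsto (fun n : ℕ => (Matrix.of fun (p q : ↥(box 3 n)) => criticalTwoPoint 3 (q.1 - p.1))⁻¹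
        ⟨0, zero_mem_box 3 n⟩ ⟨0, zero_mem_box 3 n⟩) Filter.atTop (nhds A₀) →
      (∀ n : ℕ, (Matrix.of fun (p q : ↥(box 3 n)) => criticalTwoPoint 3 (q.1 - p.1))⁻¹
        ⟨0, zero_mem_box 3 n⟩ ⟨0, zero_mem_box 3 n⟩ ≤ A₀) → 0 < A₀ →
    (∃ c₀ : ℝ, 0 < c₀ ∧ ∀ (d m : ℝ), 0 < d → 0 < m → ∃ B : ℝ,
      ∀ u : Site 3, (∃ i : Fin 3, u = Pi.single i 1) →
      ∀ p : Fin 3 → ℝ, (∀ n : ℤ, d ≤ |(∑ j, p j * (u j : ℝ)) - 2 * Real.pi * n|) →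
        (∀ (t : ℝ) (L : Fin 3 → ℤ), m ≤ ‖(fun j => p j + t * ((u j : ℝ) / ∑ l, ((u l : ℝ)) ^ 2)
          - 2 * Real.pi * (L j : ℝ))‖) →
        ∃ F : ℂ → ℂ, DifferentiableOn ℂ F (Metric.ball (0 : ℂ) (c₀ * d)) ∧
          (∀ s : ℝ, |s| < c₀ * d →
            F (s : ℂ) = (((1 - ∑' x : Site 3, (if x = 0 then (0 : ℝ) else
              (⨅ A : {A : Finset (Site 3) // (0 : Site 3) ∈ A ∧ x ∈ A}, -((Matrix.of fun (p q : ↥A.1) =>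
                criticalTwoPoint 3 (q.1 - p.1))⁻¹ ⟨0, A.2.1⟩ ⟨x, A.2.2⟩))) / A₀ *
              Real.cos (∑ j, (p j + s * ((u j : ℝ) / ∑ l, ((u l : ℝ)) ^ 2)) * ((x j : ℤ) : ℝ)))⁻¹ : ℝ) : ℂ)) ∧
          (∀ z : ℂ, ‖z‖ < c₀ * d → ‖F z‖ ≤ B)) →
    (∃ c₀ : ℝ, 0 < c₀ ∧ ∀ (d m : ℝ), 0 < d → 0 < m → ∃ B : ℝ,
      ∀ u : Site 3, (∃ i j : Fin 3, i ≠ j ∧ (u = Pi.single i 1 + Pi.single j 1 ∨ u = Pi.single i 1 - Pi.single j 1)) →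
      ∀ p : Fin 3 → ℝ, (∀ n : ℤ, d ≤ |(∑ j, p j * (u j : ℝ)) - 2 * Real.pi * n|) →
        (∀ (t : ℝ) (L : Fin 3 → ℤ), m ≤ ‖(fun j => p j + t * ((u j : ℝ) / ∑ l, ((u l : ℝ)) ^ 2)
          - 2 * Real.pi * (L j : ℝ))‖) →
        ∃ F : ℂ → ℂ, DifferentiableOn ℂ F (Metric.ball (0 : ℂ) (c₀ * d)) ∧
          (∀ s : ℝ, |s| < c₀ * d →
            F (s : ℂ) = (((1 - ∑' x : Site 3, (if x = 0 then (0 : ℝ) else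
              (⨅ A : {A : Finset (Site 3) // (0 : Site 3) ∈ A ∧ x ∈ A}, -((Matrix.of fun (p q : ↥A.1) =>
                criticalTwoPoint 3 (q.1 - p.1))⁻¹ ⟨0, A.2.1⟩ ⟨x, A.2.2⟩))) / A₀ *
              Real.cos (∑ j, (p j + s * ((u j : ℝ) / ∑ l, ((u l : ℝ)) ^ 2)) * ((x j : ℤ) : ℝ)))⁻¹ : ℝ) : ℂ)) ∧
          (∀ z : ℂ, ‖z‖ < c₀ * d → ‖F z‖ ≤ B)) →
    ∃ c₀ : ℝ, 0 < c₀ ∧ ∀ (d m : ℝ), 0 < d → 0 < m → ∃ B : ℝ,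
      ∀ u : Site 3, ((∃ i : Fin 3, u = Pi.single i 1) ∨
          ∃ i j : Fin 3, i ≠ j ∧ (u = Pi.single i 1 + Pi.single j 1 ∨ u = Pi.single i 1 - Pi.single j 1)) →
      ∀ p : Fin 3 → ℝ, (∀ n : ℤ, d ≤ |(∑ j, p j * (u j : ℝ)) - 2 * Real.pi * n|) →
        (∀ (t : ℝ) (L : Fin 3 → ℤ), m ≤ ‖(fun j => p j + t * ((u j : ℝ) / ∑ l, ((u l : ℝ)) ^ 2)
          - 2 * Real.pi * (L j : ℝ))‖) →
        ∃ F : ℂ → ℂ, DifferentiableOn ℂ F (Metric.ball (0 : ℂ) (c₀ * d)) ∧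
          (∀ s : ℝ, |s| < c₀ * d →
            F (s : ℂ) = (((1 - ∑' x : Site 3, (if x = 0 then (0 : ℝ) else
              (⨅ A : {A : Finset (Site 3) // (0 : Site 3) ∈ A ∧ x ∈ A}, -((Matrix.of fun (p q : ↥A.1) =>
                criticalTwoPoint 3 (q.1 - p.1))⁻¹ ⟨0, A.2.1⟩ ⟨x, A.2.2⟩))) / A₀ *
              Real.cos (∑ j, (p j + s * ((u j : ℝ) / ∑ l, ((u l : ℝ)) ^ 2)) * ((x j : ℤ) : ℝ)))⁻¹ : ℝ) : ℂ)) ∧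
          (∀ z : ℂ, ‖z‖ < c₀ * d → ‖F z‖ ≤ B) := by
  intro _ A₀ _ _ _ hax hdg
  obtain ⟨ca, hca, hax⟩ := hax
  obtain ⟨cd, hcd, hdg⟩ := hdg
  refine ⟨min ca cd, lt_min hca hcd, fun d m hd hm => ?_⟩
  obtain ⟨Ba, hBa⟩ := hax d m hd hm
  obtain ⟨Bd, hBd⟩ := hdg d m hd hm
  refine ⟨max Ba Bd, fun u hu p hp hline => ?_⟩
  have hmono_a : min ca cd * d ≤ ca * d := mul_le_mul_of_nonneg_right (min_le_left _ _) hd.le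
  have hmono_d : min ca cd * d ≤ cd * d := mul_le_mul_of_nonneg_right (min_le_right _ _) hd.le
  rcases hu with hu | hu
  · obtain ⟨F, hF, htr, hbd⟩ := hBa u hu p hp hline
    refine ⟨F, hF.mono (Metric.ball_subset_ball hmono_a), fun s hs => htr s (lt_of_lt_of_le hs hmono_a),
      fun z hz => (hbd z (lt_of_lt_of_le hz hmono_a)).trans (le_max_left _ _)⟩
  · obtain ⟨F, hF, htr, hbd⟩ := hBd u hu p hp hline
    refine ⟨F, hF.mono (Metric.ball_subset_ball hmono_d), fun s hs => htr s (lt_of_lt_of_le hs hmono_d),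
      fun z hz => (hbd z (lt_of_lt_of_le hz hmono_d)).trans (le_max_right _ _)⟩

/-- **The crux follows from its existence core** (registered bookkeeping stub `stub_closureModuloCore`; the
hypothesis is the registered signature of the open stub `stub_tailRegularVariation`, verbatim). -/
theorem stub_closureModuloCore :
    ((∀ A : Finset (Site 3), (Matrix.of fun (p q : ↥A) => criticalTwoPoint 3 (q.1 - p.1)).PosDef ∧ ∀ u v :
      ↥A, (u ≠ v → (Matrix.of fun (p q : ↥A) => criticalTwoPoint 3 (q.1 - p.1))⁻¹ u v ≤ 0) ∧ 0 ≤ ∑ w,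
      (Matrix.of fun (p q : ↥A) => criticalTwoPoint 3 (q.1 - p.1))⁻¹ u w) →
    Summable (fun x : Site 3 => (⨅ A : {A : Finset (Site 3) // (0 : Site 3) ∈ A ∧ x ∈ A}, -((Matrix.of fun
      (p q : ↥A.1) => criticalTwoPoint 3 (q.1 - p.1))⁻¹ ⟨0, A.2.1⟩ ⟨x, A.2.2⟩))) →
    (∀ (i : Fin 3) (k : Fin 2 → ℝ), ∃ τ : MeasureTheory.Measure ℝ, MeasureTheory.IsFiniteMeasure τ ∧ τ
      (Set.Icc (0 : ℝ) 1)ᶜ = 0 ∧ ∀ n : ℕ, 1 ≤ n → (∑' y : Fin 2 → ℤ, (⨅ A : {A : Finset (Site 3) // (0 :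
      Site 3) ∈ A ∧ (Fin.insertNth i (n : ℤ) (y) : Site 3) ∈ A}, -((Matrix.of fun (p q : ↥A.1) =>
      criticalTwoPoint 3 (q.1 - p.1))⁻¹ ⟨0, A.2.1⟩ ⟨(Fin.insertNth i (n : ℤ) (y) : Site 3), A.2.2⟩)) *
      Real.cos (∑ j, k j * (y j : ℝ))) = ∫ t, t ^ (n - 1) ∂τ) →
    (∃ c : ℝ, 0 < c ∧ ∀ (i : Fin 3) (k : Fin 2 → ℝ), (∀ j, |k j| ≤ Real.pi) → ∀ n : ℕ, 1 ≤ n → (∑' y : Fin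
      2 → ℤ, (⨅ A : {A : Finset (Site 3) // (0 : Site 3) ∈ A ∧ (Fin.insertNth i ((n + 1 : ℕ) : ℤ) (y) :
      Site 3) ∈ A}, -((Matrix.of fun (p q : ↥A.1) => criticalTwoPoint 3 (q.1 - p.1))⁻¹ ⟨0, A.2.1⟩
      ⟨(Fin.insertNth i ((n + 1 : ℕ) : ℤ) (y) : Site 3), A.2.2⟩)) * Real.cos (∑ j, k j * (y j : ℝ))) ≤
      Real.exp (-(c * ‖k‖)) * (∑' y : Fin 2 → ℤ, (⨅ A : {A : Finset (Site 3) // (0 : Site 3) ∈ A ∧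
      (Fin.insertNth i (n : ℤ) (y) : Site 3) ∈ A}, -((Matrix.of fun (p q : ↥A.1) => criticalTwoPoint 3 (q.1
      - p.1))⁻¹ ⟨0, A.2.1⟩ ⟨(Fin.insertNth i (n : ℤ) (y) : Site 3), A.2.2⟩)) * Real.cos (∑ j, k j * (y j :
      ℝ)))) →
    ∃ η c : ℝ, 0 < η ∧ η < 1 ∧ 0 < c ∧
    (∀ i : Fin 3, Filter.Tendsto (fun n : ℕ => (∑' y : Fin 2 → ℤ, (⨅ A : {A : Finset (Site 3) // (0 : Site
      3) ∈ A ∧ (Fin.insertNth i (n : ℤ) (y) : Site 3) ∈ A}, -((Matrix.of fun (p q : ↥A.1) =>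
      criticalTwoPoint 3 (q.1 - p.1))⁻¹ ⟨0, A.2.1⟩ ⟨(Fin.insertNth i (n : ℤ) (y) : Site 3), A.2.2⟩))) * (n
      : ℝ) ^ (3 - η)) Filter.atTop (nhds c)) ∧
    (∀ f : (Fin 3 → ℝ) → ℝ, Continuous f → HasCompactSupport f → (0 : Fin 3 → ℝ) ∉ tsupport f → ∃ L : ℝ,
      Filter.Tendsto (fun R : ℕ => (R : ℝ) ^ (2 - η) * ∑' x : Site 3, (⨅ A : {A : Finset (Site 3) // (0 :
      Site 3) ∈ A ∧ x ∈ A}, -((Matrix.of fun (p q : ↥A.1) => criticalTwoPoint 3 (q.1 - p.1))⁻¹ ⟨0, A.2.1⟩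
      ⟨x, A.2.2⟩)) * f (fun j => (x j : ℝ) / (R : ℝ))) Filter.atTop (nhds L))) →
    Summit.CriticalPhenomena.Ising3DConformalLimit.Theses.PrecisionLaplacian.DirectCorrelationStableTail := by
  intro hcore hH
  -- structure of the direct correlation function: summable, hyperoctahedrally invariant, nonnegative off 0
  obtain ⟨hsum, hsymm⟩ := stub_dcfStructure hH
  have hnn : ∀ x : Site 3, x ≠ 0 → 0 ≤ (fun x : Site 3 => (⨅ A : {A : Finset (Site 3) // (0 : Site 3) ∈ A ∧ x ∈ A}, -((Matrix.of fun (p q : ↥A.1) => criticalTwoPoint 3 (q.1 - p.1))⁻¹ ⟨0, A.2.1⟩ ⟨x, A.2.2⟩))) x := by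
    intro x hx
    haveI : Nonempty {A : Finset (Site 3) // (0 : Site 3) ∈ A ∧ x ∈ A} := ⟨⟨{0, x}, by simp, by simp⟩⟩
    refine le_ciInf fun A => ?_
    exact neg_nonneg.2 (((hH A.1).2 _ _).1 fun e => hx (Subtype.ext_iff.mp e).symm)
  -- Hausdorff slab modes (Pick inversion of the slab spectral representation)
  have hHaus := stub_pickInversion hH hsum stub_slabSpectralRepresentation
  -- the transverse mass gap
  obtain ⟨A₀, hT, hle, hpos⟩ := Summit.CriticalPhenomena.Ising3DConformalLimit.Theorems.EtaBoundsTransfer.exists_A0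
    (d := 3) (G := criticalTwoPoint 3)
    (M := fun A : Finset (Site 3) => Matrix.of fun (p q : ↥A) => criticalTwoPoint 3 (q.1 - p.1))
    (k := fun n : ℕ => (Matrix.of fun (p q : ↥(box 3 n)) => criticalTwoPoint 3 (q.1 - p.1))⁻¹
      ⟨0, zero_mem_box 3 n⟩ ⟨0, zero_mem_box 3 n⟩)
    (fun _ => rfl) hH criticalTwoPoint_tendsto_zero_cofinite (fun _ => rfl)
  have hLH := lineHol_nine_of_axis_of_diag hH A₀ hT hle hpos
    (stub_slabModeExpDecay_auxAxisLineHol hH A₀ hT hle hpos) (stub_slabModeExpDecay_auxDiagLineHol hH A₀ hT hle hpos)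
  obtain ⟨c₁, hc₁, hdec⟩ := stub_slabModeExpDecay_auxCrossAssembly hH A₀ hT hle hpos hLH stub_crossLemma
  obtain ⟨c, hc, hdecay⟩ := stub_slabModeExpDecay_auxGreenTransfer hH ⟨c₁, hc₁, fun A₀' hT' _ _ => by
    have hA : A₀' = A₀ := tendsto_nhds_unique hT' hT
    subst hA
    exact hdec⟩
  have hGap := transverseGap_of_hausdorff_of_eventually_expDecay (fun x : Site 3 => (⨅ A : {A : Finset (Site 3) // (0 : Site 3) ∈ A ∧ x ∈ A}, -((Matrix.of fun (p q : ↥A.1) => criticalTwoPoint 3 (q.1 - p.1))⁻¹ ⟨0, A.2.1⟩ ⟨x, A.2.2⟩))) hHaus c hdecay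
  -- the existence core, then regularity at scale and the pointwise upgrade
  obtain ⟨η, c', hη0, hη1, hc', hrad, htmc⟩ := hcore hH hsum hHaus ⟨c, hc, hGap⟩
  exact stub_pointwiseUpgrade (fun x : Site 3 => (⨅ A : {A : Finset (Site 3) // (0 : Site 3) ∈ A ∧ x ∈ A}, -((Matrix.of fun (p q : ↥A.1) => criticalTwoPoint 3 (q.1 - p.1))⁻¹ ⟨0, A.2.1⟩ ⟨x, A.2.2⟩))) η c' hnn hη0 hη1 hc' hrad
    (stub_scaleRegularity (fun x : Site 3 => (⨅ A : {A : Finset (Site 3) // (0 : Site 3) ∈ A ∧ x ∈ A}, -((Matrix.of fun (p q : ↥A.1) => criticalTwoPoint 3 (q.1 - p.1))⁻¹ ⟨0, A.2.1⟩ ⟨x, A.2.2⟩))) η c' hnn hsymm hHaus ⟨c, hc, hGap⟩ hη0 hη1 hc' hrad) htmc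

end Summit.CriticalPhenomena.Ising3DConformalLimit.Cruxes.DirectCorrelationStableTail.SelfEnergyPickInversion

end
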